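import Summits.BirchSwinnertonDyer.BirchSwinnertonDyer.Theorems.SignedLowerHalvesSmallImageLowerHalfBothSignsLambdaLowerThreeNsThetaTransport
import Summits.BirchSwinnertonDyer.BirchSwinnertonDyer.Theorems.EisensteinPrimesAnalyticLambdaCalculus
import Summits.BirchSwinnertonDyer.Rank1Residual.X2.GreenbergVatsalCaseTwo
import HarnessLib

/-!
# Route `SignedLowerHalves`, crux L `SmallImageLowerHalfBothSigns` (item stmt-BirchSwinnertonDyer-23599), line `rtt_w3`:
# the ONE-SIDED engine Kλ₂^≥ SPLITS as (AN_W) ∧ (ENG) — W-side layer bookkeeping + a carrier-free partner inequality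

LEAD `cruxlead-stmt-BirchSwinnertonDyer-23599` g0 (cell `bsd-ssimc`); ROUTE-INDEPENDENT helper (`--supports
stmt-BirchSwinnertonDyer-23599`); THEOREMS ONLY — no definition, no named fact, no `sorry`; closes nothing; BSD is not proved
by any of this.

HONEST FRAMING. Parts 1′–4′ (`…RttOneSidedCore`, p739698; `…RttOneSidedCrux`, p741163) cut the engine of line `rtt_w3` to the
inequality Kλ₂^≥ «`λ_n(θ^{S₀}_n(g)) − λ_n(θ^{S₀}_n(W)) ≤ λ(X^ε) − λ(G)` for `n ≫ 0` of the parity of `ε`». This file shows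
that Kλ₂^≥ is the conjunction of two statements of very different grade, so that the skeleton can register them separately:

* **(AN_W) W-side layer bookkeeping** — for the conductor-level newform `f` of `W`, ANY Pollack pair `(L⁺, L⁻)`
  (`IsPollackPair`: `θ_n ≡ ±ω_n^∓ L^∓ (mod ω_n)`, Pollack 2003 Prop 6.18) and any finite `S₀ ∌ p`:
  `λ_n(θ^{S₀}_n(f)) = λ(L^ε) + Σ_{v∈S₀} λ_n(𝒫^{(n)}_v) + deg ω_n^{−ε}` for `n ≫ 0` of the parity of `ε`
  (`deg ω_n^{−ε} = q_n` of Pollack–Weston 2011 Thm 4.1; `𝒫^{(n)}_v = P_v(ℓ⁻¹(1+T)^{[−f_ℓ]_n})` the layer-`n` Euler factor,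
  `μ(𝒫_v) = 0`, `λ(𝒫_v) = δ_v` of Greenberg–Vatsal Prop (2.4)). KERNEL ALGEBRA over the tree's definitions (Weierstrass
  division by `ω_n ≡ T^{pⁿ} (mod p)`, Gauss's lemma for the sup norm); benchable; size M.
* **(ENG) the engine proper, CARRIER-FREE** — for every level-matched CM partner `(M, g, ι, Ω)` (cohomological period),
  cyclotomic `(κ, γ)`, admissible `S₀` and signed dual datum `D` of `W` of sign `ε` (f.g., torsion, `μ = 0`):
  `λ_n(θ^{S₀}_n(g)^ι) ≤ deg ω_n^{−ε} + λ(X^ε_W) + Σ_{v∈S₀} λ_n(𝒫^{W,(n)}_v)` for `n ≫ 0` of the parity of `ε`.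
  In print: `λ_n(θ^{S₀}_n(g)) = q_n + λ(L^ε_g) + Σ δ_v(g)` (Pollack 2003 for `g` / Kurihara–Perrin-Riou = PW 2011 Thm 4.1, GV §2)
  ∧ `λ(L^ε_g) ≤ λ(X^ε_g)` (the CM partner's main conjecture, EQUALITY direction: Pollack–Rubin 2004 for rational `g`;
  Rubin 1991 / Johnson-Leung–Kings 2011 + descent + Lei 2011 Cor 6.9 otherwise) ∧ `λ(X^ε_g) + Σδ_v(g) = λ(X^ε_W) + Σδ_v(W)`
  (Hatley–Lei 2019 Thm 4.6, `μ(X^ε_W) = 0`; B. D. Kim 2009 Cor 2.13 for a CM-CURVE partner) ∧ `δ_v(W) = λ_n(𝒫^{W,(n)}_v)`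
  (GV Prop (2.4)). Neither the partner's Selmer group NOR its `p`-adic `L`-function appears in the statement. Size XL.

* §1 `lam_eq_of_iota_eq_C_mul` — `λ` is blind to a rescaling by a non-zero constant of `ℚ_p`
  (so `λ(G) = λ(L^ε_W)` for `ι G = C(p^m ϖ)·ι L^ε`, `ϖ ≠ 0`).
* §2 `residualThetaMC_ge_of_anW_of_eng` — per pair and sign: (AN_W) ∧ (ENG) ⟹ Kλ₂^≥ (integer arithmetic + §1).

References: [Pollack2003] Thm. 5.6, Cor. 5.11, Prop. 6.18; [PollackWeston2011MT] §2.2 Def. 2.1, §3.1 Lemmas 3.1–3.3, Thm. 4.1;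
[GreenbergVatsal2000] §2 Prop. (2.4), (7); [BDKim2009] Prop. 2.6, Cor. 2.13; [HatleyLei2019] Thm. 4.6; [PollackRubin2004]
Theorem (p. 448); [Lei2011] Cor. 6.9, §7; [Washington1997] §7.1.
-/

set_option autoImplicit false
-- D-0017: single-problem summit, the namespace repeats the problem name by design.
set_option linter.dupNamespace false
noncomputable section

open scoped Classical MatrixGroups ModularForm BigOperators

open CongruenceSubgroup WeierstrassCurve Field Polynomial NumberField IsDedekindDomain
  Literature.NumberTheory.EllipticCurves Literature.NumberTheory.EllipticCurves.ModularForms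
  Literature.NumberTheory.EllipticCurves.Rank1Residual
  Literature.NumberTheory.EllipticCurves.Kobayashi2003
  Literature.NumberTheory.EllipticCurves.GreenbergVatsal2000 ZpExtension
  Literature.NumberTheory.IwasawaTheory Rat.HeightOneSpectrum
  Summit.BirchSwinnertonDyer.Rank1Residual.Supersingular
  Summit.BirchSwinnertonDyer.Rank1Residual.X1.MuLambda
  Summit.BirchSwinnertonDyer.BirchSwinnertonDyer.Theorems.SmallImageLambdaLowerThreeNsThetaTransport

namespace Summit.BirchSwinnertonDyer.BirchSwinnertonDyer.Theorems.SmallImageRttOneSided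

/-! ## §1 `λ` does not see a rescaling by a non-zero constant of `ℚ_p` -/

section Rescale

variable {p : ℕ} [Fact p.Prime]

/-- **Rescaling preserves `λ`**: for `G, L ∈ Λ ∖ 0` and `x ∈ ℚ_p ∖ 0` with `ι G = C x · ι L`, `λ(G) = λ(L)` (if `‖x‖ ≤ 1`
then `G = C x · L`, else `L = C x⁻¹ · G`; `λ(C c · h) = λ(h)`, `EisensteinPrimesAnalyticLambdaCalculus.lam_C_mul`). [folklore]
[cite: Washington1997, §7.1 (Weierstrass preparation)] -/
theorem lam_eq_of_iota_eq_C_mul {G L : IwasawaAlgebra p} (hG : G ≠ 0) (hL : L ≠ 0) {x : ℚ_[p]} (hx : x ≠ 0)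
    (h : iwasawaToPowerSeries p G = PowerSeries.C x * iwasawaToPowerSeries p L) : lam G = lam L := by
  by_cases hx1 : ‖x‖ ≤ 1
  · set c : ℤ_[p] := ⟨x, hx1⟩ with hc
    have hc0 : c ≠ 0 := by
      intro h0; apply hx; have := congrArg ((↑) : ℤ_[p] → ℚ_[p]) h0; simpa [hc] using this
    have hGeq : G = PowerSeries.C c * L := by
      apply iwasawaToPowerSeries_injective p
      rw [Summit.BirchSwinnertonDyer.Rank1Residual.X2.GreenbergVatsalCaseTwo.iwasawaToPowerSeries_C_mul, h]
    rw [hGeq, Summit.BirchSwinnertonDyer.BirchSwinnertonDyer.Theorems.EisensteinPrimesAnalyticLambdaCalculus.lam_C_mul hc0 hL]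
  · have hx1' : ‖x⁻¹‖ ≤ 1 := by
      rw [norm_inv]; exact inv_le_one_of_one_le₀ (le_of_lt (not_le.mp hx1))
    set c : ℤ_[p] := ⟨x⁻¹, hx1'⟩ with hc
    have hc0 : c ≠ 0 := by
      intro h0; apply inv_ne_zero hx; have := congrArg ((↑) : ℤ_[p] → ℚ_[p]) h0; simpa [hc] using this
    have hLeq : L = PowerSeries.C c * G := by
      apply iwasawaToPowerSeries_injective p
      rw [Summit.BirchSwinnertonDyer.Rank1Residual.X2.GreenbergVatsalCaseTwo.iwasawaToPowerSeries_C_mul, h, ← mul_assoc,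
        ← map_mul]
      have : ((c : ℤ_[p]) : ℚ_[p]) * x = 1 := by rw [hc]; exact inv_mul_cancel₀ hx
      rw [this, map_one, one_mul]
    rw [hLeq, Summit.BirchSwinnertonDyer.BirchSwinnertonDyer.Theorems.EisensteinPrimesAnalyticLambdaCalculus.lam_C_mul hc0 hG]

end Rescale

/-! ## §2 Kλ₂^≥ ⟸ (AN_W) ∧ (ENG), per pair and sign -/

section Split

variable (W : WeierstrassCurve ℚ) [W.IsElliptic] [W.IsGloballyMinimal] (p : ℕ) [Fact p.Prime]

omit [W.IsElliptic] in
/-- **The one-sided engine Kλ₂^≥ of line `rtt_w3` from (AN_W) ∧ (ENG)**, at a pair `(W, p)` and a sign `ε`. GIVEN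
`hAN` : the W-side layer bookkeeping (for the newform `f`, every Pollack pair and every finite `S₀ ∌ p`:
`λ_n(θ^{S₀}_n(f)) = λ(L^ε) + Σ_v λ_n(𝒫^{(n)}_v) + deg ω_n^{−ε}` for `n ≫ 0` of the parity of `ε`) and `hENG` : the carrier-free
partner inequality (for every level-matched CM partner with cohomological period, cyclotomic `(κ, γ)`, admissible `S₀`, signed dual
datum `D` of sign `ε`, f.g. torsion with `μ = 0`: `λ_n(θ^{S₀}_n(g)^ι) ≤ deg ω_n^{−ε} + λ(X^ε_W) + Σ_v λ_n(𝒫^{W,(n)}_v)` for `n ≫ 0`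
of that parity), THEN the v3 engine text holds at `(W, p, ε)`: for every `G` with `ι G = C(p^m ϖ)·ι L^ε`,
`λ_n(θ^{S₀}_n(g)) − λ_n(θ^{S₀}_n(f)) ≤ λ(X^ε_W) − λ(G)` for `n ≫ 0` of the parity of `ε` (`λ(G) = λ(L^ε)` by §1, `ϖ ≠ 0` from
`ϖ·Ω_W = Ω⁺_f`). Integer arithmetic; nothing is asserted. [cite: PollackWeston2011MT, §3.1, Thm. 4.1]
[cite: Pollack2003, Prop. 6.18] [cite: GreenbergVatsal2000, §2 Prop. (2.4)] [cite: HatleyLei2019, Thm. 4.6] -/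
theorem residualThetaMC_ge_of_anW_of_eng (ε : ℤˣ)
    (hAN : ∀ [NeZero (W.conductorNorm ℤ)] (f : CuspForm (Gamma0 (W.conductorNorm ℤ)) 2), IsNewformOf W f →
        ∀ (Lplus Lminus : IwasawaAlgebra p), IsPollackPair f p Lplus Lminus →
        ∀ (S₀ : Finset (HeightOneSpectrum (𝓞 ℚ))), (∀ v ∈ S₀, ((p : ℕ) : 𝓞 ℚ) ∉ v.asIdeal) →
        ∃ n₀ : ℕ, ∀ n ≥ n₀, (Even n ↔ ε = 1) →
          ((layerLambda (((mazurTateElement f p n).map (algebraMap ℚ (PadicAlgCl p)) *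
              ∏ v ∈ S₀, ((W.localPolynomialAt v).map (Int.castRingHom (PadicAlgCl p))).comp
                (C ((natGenerator v : PadicAlgCl p)⁻¹) *
                  (X + 1) ^ (PadicInt.toZModPow n (-(frobeniusExponent p (natGenerator v : ℤ_[p])))).val)) %ₘ
              ((X + 1) ^ p ^ n - 1)) : ℕ) : ℤ) =
            ((lam (kobayashiL ε Lplus Lminus) : ℕ) : ℤ) +
              (∑ v ∈ S₀, ((layerLambda (((W.localPolynomialAt v).map (Int.castRingHom (PadicAlgCl p))).comp
                (C ((natGenerator v : PadicAlgCl p)⁻¹) *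
                  (X + 1) ^ (PadicInt.toZModPow n (-(frobeniusExponent p (natGenerator v : ℤ_[p])))).val)) : ℕ) : ℤ)) + ((if ε = 1 then cyclotomicOmegaMinus p n else cyclotomicOmegaPlus p n).natDegree : ℤ))
    (hENG : ∀ (M : ℕ) [NeZero M] (g : CuspForm (Gamma0 M) 2) (ι : coeffField g →+* PadicAlgCl p) (Ω : ℂ),
        ¬ p ∣ M → (∀ ℓ : ℕ, ℓ.Prime → ℓ ≠ p → max 2 (padicValNat ℓ M) = max 2 (padicValNat ℓ (W.conductorNorm ℤ))) →
        IsNewform0 g → Literature.NumberTheory.Automorphic.IsCMForm (liftToGamma1 M 2 g) →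
        cuspCoeff g p = 0 → IsCohomologicalPlusPeriod g ι Ω →
        (∀ ℓ : ℕ, ℓ.Prime → ¬ ℓ ∣ p * M * W.conductorNorm ℤ →
          ‖embCoeff g ι ℓ - (W.frobeniusTrace ℓ : PadicAlgCl p)‖ < 1) →
        ∀ (κ : ZpExtension ℚ p) (γ : absoluteGaloisGroup ℚ),
          κ.IsCyclotomic → κ.IsTopGenerator γ → IsCyclotomicVariable p γ →
        ∀ (S₀ : Finset (HeightOneSpectrum (𝓞 ℚ))), (∀ v ∈ S₀, ((p : ℕ) : 𝓞 ℚ) ∉ v.asIdeal) →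
          (∀ v : HeightOneSpectrum (𝓞 ℚ), ¬ W.HasGoodReductionAt v → v ∈ S₀) →
          (∀ v : HeightOneSpectrum (𝓞 ℚ), natGenerator v ∣ M → v ∈ S₀) →
        ∀ (D : SignedSelmerDualData W κ γ ε) [Module.Finite (IwasawaAlgebra p) D.X],
          Module.IsTorsion (IwasawaAlgebra p) D.X → D.mu = 0 →
        ∃ n₀ : ℕ, ∀ n ≥ n₀, (Even n ↔ ε = 1) →
          ((layerLambda (((mazurTateElementK g Ω p n).map ι *
              ∏ v ∈ S₀, (1 - C (embCoeff g ι (natGenerator v)) * X +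
                  (if natGenerator v ∣ M then 0 else C (natGenerator v : PadicAlgCl p)) * X ^ 2).comp
                (C ((natGenerator v : PadicAlgCl p)⁻¹) *
                  (X + 1) ^ (PadicInt.toZModPow n (-(frobeniusExponent p (natGenerator v : ℤ_[p])))).val)) %ₘ
              ((X + 1) ^ p ^ n - 1)) : ℕ) : ℤ) ≤
            ((if ε = 1 then cyclotomicOmegaMinus p n else cyclotomicOmegaPlus p n).natDegree : ℤ) + ((lambdaInvariant p D.X : ℕ) : ℤ) +
              (∑ v ∈ S₀, ((layerLambda (((W.localPolynomialAt v).map (Int.castRingHom (PadicAlgCl p))).comp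
                (C ((natGenerator v : PadicAlgCl p)⁻¹) *
                  (X + 1) ^ (PadicInt.toZModPow n (-(frobeniusExponent p (natGenerator v : ℤ_[p])))).val)) : ℕ) : ℤ))) :
    ∀ (M : ℕ) [NeZero M] (g : CuspForm (Gamma0 M) 2) (ι : coeffField g →+* PadicAlgCl p) (Ω : ℂ),
        ¬ p ∣ M → (∀ ℓ : ℕ, ℓ.Prime → ℓ ≠ p → max 2 (padicValNat ℓ M) = max 2 (padicValNat ℓ (W.conductorNorm ℤ))) →
        IsNewform0 g → Literature.NumberTheory.Automorphic.IsCMForm (liftToGamma1 M 2 g) →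
        cuspCoeff g p = 0 → IsCohomologicalPlusPeriod g ι Ω →
        (∀ ℓ : ℕ, ℓ.Prime → ¬ ℓ ∣ p * M * W.conductorNorm ℤ →
          ‖embCoeff g ι ℓ - (W.frobeniusTrace ℓ : PadicAlgCl p)‖ < 1) →
        ∀ (κ : ZpExtension ℚ p) (γ : absoluteGaloisGroup ℚ),
          κ.IsCyclotomic → κ.IsTopGenerator γ → IsCyclotomicVariable p γ →
        ∀ [NeZero (W.conductorNorm ℤ)] (f : CuspForm (Gamma0 (W.conductorNorm ℤ)) 2), IsNewformOf W f →
        ∀ (ϖ : ℚ), (ϖ : ℝ) * W.realPeriodRat = plusPeriod f →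
        ∀ (Lplus Lminus : IwasawaAlgebra p), IsPollackPair f p Lplus Lminus →
        ∀ (S₀ : Finset (HeightOneSpectrum (𝓞 ℚ))), (∀ v ∈ S₀, ((p : ℕ) : 𝓞 ℚ) ∉ v.asIdeal) →
          (∀ v : HeightOneSpectrum (𝓞 ℚ), ¬ W.HasGoodReductionAt v → v ∈ S₀) →
          (∀ v : HeightOneSpectrum (𝓞 ℚ), natGenerator v ∣ M → v ∈ S₀) →
        ∀ (D : SignedSelmerDualData W κ γ ε) [Module.Finite (IwasawaAlgebra p) D.X],
          Module.IsTorsion (IwasawaAlgebra p) D.X → D.mu = 0 →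
        ∀ (G : IwasawaAlgebra p) (m : ℕ),
          iwasawaToPowerSeries p G =
            PowerSeries.C ((p : ℚ_[p]) ^ m * (ϖ : ℚ_[p])) * iwasawaToPowerSeries p (kobayashiL ε Lplus Lminus) →
        ∃ n₀ : ℕ, ∀ n ≥ n₀, (Even n ↔ ε = 1) →
          ((layerLambda (((mazurTateElementK g Ω p n).map ι *
              ∏ v ∈ S₀, (1 - C (embCoeff g ι (natGenerator v)) * X +
                  (if natGenerator v ∣ M then 0 else C (natGenerator v : PadicAlgCl p)) * X ^ 2).comp
                (C ((natGenerator v : PadicAlgCl p)⁻¹) *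
                  (X + 1) ^ (PadicInt.toZModPow n (-(frobeniusExponent p (natGenerator v : ℤ_[p])))).val)) %ₘ
              ((X + 1) ^ p ^ n - 1)) : ℕ) : ℤ) -
            ((layerLambda (((mazurTateElement f p n).map (algebraMap ℚ (PadicAlgCl p)) *
              ∏ v ∈ S₀, ((W.localPolynomialAt v).map (Int.castRingHom (PadicAlgCl p))).comp
                (C ((natGenerator v : PadicAlgCl p)⁻¹) *
                  (X + 1) ^ (PadicInt.toZModPow n (-(frobeniusExponent p (natGenerator v : ℤ_[p])))).val)) %ₘ
              ((X + 1) ^ p ^ n - 1)) : ℕ) : ℤ) ≤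
          ((lambdaInvariant p D.X : ℕ) : ℤ) - ((lam G : ℕ) : ℤ) := by
  intro M _ g ι Ω hpM hlev hnew hcm hapg hΩ hcong κ γ hκ hγ hγ' _ f hf ϖ hϖ Lplus Lminus hPP S₀ hS₀p hS₀W hS₀M D _
    hXt hμ G m hG
  obtain ⟨n₁, hn₁⟩ := hAN f hf Lplus Lminus hPP S₀ hS₀p
  obtain ⟨n₃, hn₃⟩ := hENG M g ι Ω hpM hlev hnew hcm hapg hΩ hcong κ γ hκ hγ hγ' S₀ hS₀p hS₀W hS₀M D hXt hμ
  -- `λ(G) = λ(L^ε_W)`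
  set L := kobayashiL ε Lplus Lminus with hLdef
  have hL0 : L ≠ 0 := by
    rcases Int.units_eq_one_or ε with rfl | rfl
    · simpa [hLdef, kobayashiL] using hPP.2.1
    · have : kobayashiL (-1) Lplus Lminus = Lplus := by simp [kobayashiL]
      rw [hLdef, this]; exact hPP.1
  have hϖ0 : (ϖ : ℚ_[p]) ≠ 0 := by
    exact_mod_cast Summit.BirchSwinnertonDyer.Rank1Residual.X2.varpi_ne_zero_of_isNewformOf hf hϖ
  have hx0 : (p : ℚ_[p]) ^ m * (ϖ : ℚ_[p]) ≠ 0 :=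
    mul_ne_zero (pow_ne_zero _ (by exact_mod_cast (Fact.out : p.Prime).ne_zero)) hϖ0
  have hG0 : G ≠ 0 := by
    intro h0
    have : iwasawaToPowerSeries p G = 0 := by rw [h0, map_zero]
    rw [hG] at this
    rcases mul_eq_zero.mp this with h1 | h1
    · exact hx0 (by simpa using (PowerSeries.C_injective (R := ℚ_[p])) (h1.trans (map_zero _).symm))
    · exact hL0 (iwasawaToPowerSeries_injective p (by rw [h1, map_zero]))
  have hlamG : lam G = lam L := lam_eq_of_iota_eq_C_mul hG0 hL0 hx0 hG
  refine ⟨max n₁ n₃, fun n hn hpar ↦ ?_⟩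
  have hW := hn₁ n (le_of_max_le_left hn) hpar
  have h3 := hn₃ n (le_of_max_le_right hn) hpar
  rw [hW, hlamG]
  linarith

end Split

end Summit.BirchSwinnertonDyer.BirchSwinnertonDyer.Theorems.SmallImageRttOneSided

end
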